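import Summits.QuantumFields.YangMills.Theorems.UnitScaleTiltProp7GrowthRowKnit
import Summits.QuantumFields.YangMills.Theorems.UnitScaleTiltProp7FirstVariationAssembly
import HarnessLib

/-!
# Route `UnitScaleTilt`, crux K1 child «MinimiserStabilityRegPr» (stmt-QuantumFields-19200), route-R GROWTH (W-SEAT MAP #3 row M11 «S-final (iii′)») —
# (FV-KNIT) THE FIRST-VARIATION ROW `hFV` OF `Prop7GrowthRowKnit.hrepr_of_rows` (θ = 0) FROM THE CONSTRAINT-VELOCITY ROW (CV₀) AT Θ = 0,
# BY `Prop7FirstVariationAssembly.lin_ge_neg_of_constraintVelocity`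

Cell `ym3-torus`, width seat `ym-ust-19200-w1` (gen 5 = routeR-w1 twin of record for N8 F1∕F3).  THEOREMS ONLY (0 `def`, 0 `sorry`); `--supports stmt-QuantumFields-19200
--as helper`, count-neutral.  YM₃ on T³ is a ladder rung (R3), not the Clay problem; nothing here claims the stub, the crux, d = 4 or the mass gap.

WHAT.  `hrepr_of_rows` (★w4-19200 g2, ✓ `Prop7GrowthRowKnit`) assembles `growth142_T3`'s pinned growth input from [SEL], [RP] = (ii′) and [FV] = (iii′) at `θ = 0`:
`−C_L·Σ_b‖Y_b‖² ≤ Lin_W(Y)` for the optimal pinned representative `W′^g` of every competitor, `Y = pertVar W (W′^g)`.  `lin_ge_neg_of_constraintVelocity` (★w1-19200 g0,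
✓ `Prop7FirstVariationAssembly`) gives, at a reading-R2 critical `W ∈ 𝔘_k(ε₀)`, `Lin_W(Y) ≥ −2ε₀L^{−(K−n)}Θ − (4ε₀L^{−3(K−n)} + 2ε₀L^{−(K−n)}κ)·Σ_b‖Y_b‖²` from the
constraint-velocity bound (CV) `Σ_c‖D_c‖ ≤ κΣ‖Y‖² + Θ` along any bondwise differentiable `SU(2)` family through `W` with velocities `log(1 + Y_b)W_b`.  Since the GR-KNIT is
at `θ = 0` (OWNER RULING (GR-KNIT shape) 2026-08-28 03:13:51Z) the `Σ_p‖R_p − 1‖²` slack `Θ` is not available: the row is consumed at `Θ = 0`, `κ = κ₀·L^{−(K−n)}`, giving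
**`C_L = 4ε₀L^{−3(K−n)} + 2ε₀κ₀L^{−2(K−n)}`** — inside `growth142_T3`'s window `0 ≤ ((½ − θ)/C_P − 96·178ε₄)L^{−2(K−n)} − C_L` for `ε₀` small against `1/(C_P(κ₀ + 1))`.

WHAT IS PROVED (ns `…Theorems.Prop7GrowthRowFV`).
* ★ `hFV_of_constraintVelocity` — [FV] (the `hFV` binder of `hrepr_of_rows`, VERBATIM, with the displayed `C_L`) from three DISPLAYED rows over the abstract selection
  predicate `Opt`: (SUP) `‖Y_b‖ ≤ ½`; (CV₀) `∃ Γ₀` through `W` with velocities `mlog(1 + Y_b)·W_b` and `Σ_c‖∂_s|₀ Ū^{(K−n)}(Γ₀(s))(c)‖ ≤ κ₀L^{−(K−n)}·Σ_b‖Y_b‖²`; plus the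
  base-point rows `IsCritR2 … V W`, `RegPr F n K ε₀ W`, `10¹⁰L⁶ε₀ ≤ 1`.
* `hrepr_of_SEL_RP_CV` — composed with `hrepr_of_rows`: [SEL] ∧ [RP] ∧ (SUP) ∧ (CV₀) ⟹ `growth142_T3`'s `hrepr` at `θ := 0`, `C_L` as displayed.

HONEST SCOPE.  Bookkeeping: (CV₀) at `κ₀ = O(1)` is the open analytic kernel of route-R's stub S for critical∕optimal pairs (CARD-19200-V3-g9 §8 (R), `Prop7FirstVariationAssembly`'s
header); (SUP) is the sup-regularity row of the optimal pinned representative.  Both stay DISPLAYED.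

References: T. Bałaban, CMP 102 (1985) 277–309 [Balaban1985Variational] ((141)–(143) p.299, Prop. 7 p.299, (2), (6) p.278); CMP 99 (1985) 389–434
[Balaban1985BackgroundPropagators] ((3.11) p.392); CMP 98 (1985) 17–51 [Balaban1985Averaging] ((26) p.22).
-/

set_option autoImplicit false

noncomputable section

open scoped BigOperators Matrix.Norms.L2Operator Matrix Topology

namespace Summit.QuantumFields.YangMills.Theorems.Prop7GrowthRowFV

open Literature.MathematicalPhysics.QuantumFieldTheory.Balaban1983to89
open Literature.MathematicalPhysics.QuantumFieldTheory.Balaban1983to89.T3ContinuumYM3Torus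
open Literature.MathematicalPhysics.QuantumFieldTheory.Balaban1983to89.T3PrintedRegularMinimiser (RegPr regFibrePr)
open Literature.MathematicalPhysics.QuantumFieldTheory.Balaban1983to89.T3PrintedRegularOrbits (descTransf)
open Literature.MathematicalPhysics.QuantumFieldTheory.Balaban1983to89.T3Thm1Carrier
open Literature.MathematicalPhysics.QuantumFieldTheory.Balaban1983to89.T3Thm1CarrierNative (IsCritR2)
open BlockAveragingEMLLinearisedBackground (pertVar pertVar_eq)
open MatrixLog (mlog)
open T4Continuum AveragingRT BlockAveraging BlockAveragingHaarAC BlockAveragingEMLHaarAC ExpMeanLog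
open Summit.QuantumFields.YangMills.Theorems.Prop7GrowthRowKnit (hrepr_of_rows)
open Summit.QuantumFields.YangMills.Theorems.Prop7FirstVariationAssembly (lin_ge_neg_of_constraintVelocity)

/-- ★ **(FV-KNIT) [FV] = (iii′) AT θ = 0 FROM THE CONSTRAINT-VELOCITY ROW AT Θ = 0.**  Let `W ∈ 𝔘_k(ε₀)` be reading-R2 critical in the descent fibre of `V`,
`10¹⁰L⁶ε₀ ≤ 1`, and `Opt W U` any selection predicate.  Suppose that for every competitor `W′ ∈ (6)(178ε₄) ∩ 𝔅_k(V)` and every pinned `g` (`g↓ = 1`) with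
`Opt W (W′^g)`: (SUP) `‖Y_b‖ ≤ ½`, `Y = pertVar W (W′^g)`; (CV₀) some bondwise differentiable `SU(2)` family `Γ₀` through `W` with velocities `mlog(1 + Y_b)·W_b` has
`Σ_c‖∂_s|₀ Ū^{(K−n)}(Γ₀(s))(c)‖ ≤ κ₀·L^{−(K−n)}·Σ_b‖Y_b‖²`.  THEN the `hFV` row of `hrepr_of_rows` holds with `C_L := 4ε₀L^{−3(K−n)} + 2ε₀κ₀L^{−2(K−n)}`.
[cite: Balaban1985Variational, (141)-(143) p.299, (2), (6) p.278; Balaban1985BackgroundPropagators, (3.11) p.392] -/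
theorem hFV_of_constraintVelocity (F : T3Family) {n K : ℕ} (hnK : n < K) {ε₀ ε₄ κ₀ : ℝ}
    (V : GaugeField (F.P n) 0 (Matrix.specialUnitaryGroup (Fin 2) ℂ)) (W : GaugeField (F.P K) 0 (Matrix.specialUnitaryGroup (Fin 2) ℂ))
    (Opt : GaugeField (F.P K) 0 (Matrix.specialUnitaryGroup (Fin 2) ℂ) → GaugeField (F.P K) 0 (Matrix.specialUnitaryGroup (Fin 2) ℂ) → Prop)
    (hcrit : IsCritR2 F n K hnK.le V W) (hε₀ : 0 < ε₀) (hε : 10 ^ 10 * (F.L : ℝ) ^ 6 * ε₀ ≤ 1) (hWreg : RegPr F n K ε₀ W)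
    (hSUP : ∀ W' : GaugeField (F.P K) 0 (Matrix.specialUnitaryGroup (Fin 2) ℂ), W' ∈ regFibrePr F n K hnK.le (178 * ε₄) V →
        ∀ g : GaugeTransf (F.P K) 0 (Matrix.specialUnitaryGroup (Fin 2) ℂ), descTransf F n K hnK.le g = (fun _ => 1) → Opt W (GaugeField.gaugeAct g W') →
          ∀ b : PBond (F.P K) 0, ‖pertVar W (GaugeField.gaugeAct g W') b‖ ≤ 1 / 2)
    (hCV : ∀ W' : GaugeField (F.P K) 0 (Matrix.specialUnitaryGroup (Fin 2) ℂ), W' ∈ regFibrePr F n K hnK.le (178 * ε₄) V →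
        ∀ g : GaugeTransf (F.P K) 0 (Matrix.specialUnitaryGroup (Fin 2) ℂ), descTransf F n K hnK.le g = (fun _ => 1) → Opt W (GaugeField.gaugeAct g W') →
          ∃ Γ₀ : ℝ → GaugeField (F.P K) 0 (Matrix.specialUnitaryGroup (Fin 2) ℂ), Γ₀ 0 = W ∧
            (∀ b : PBond (F.P K) 0, HasDerivAt (fun s : ℝ => (Γ₀ s b : Matrix (Fin 2) (Fin 2) ℂ))
              (mlog (1 + pertVar W (GaugeField.gaugeAct g W') b) * (W b : Matrix (Fin 2) (Fin 2) ℂ)) 0) ∧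
            ∑ c : PBond (F.P K) (K - n),
                ‖deriv (fun s : ℝ => ((Averaging.iter (fun i => blockAvg (P := F.P K) (j := i) (expMeanLogSU (n := Fin 2))) (K - n) (Γ₀ s) c :
                    Matrix.specialUnitaryGroup (Fin 2) ℂ) : Matrix (Fin 2) (Fin 2) ℂ)) 0‖
              ≤ κ₀ * ((F.L : ℝ) ^ (K - n))⁻¹ * ∑ b : PBond (F.P K) 0, ‖pertVar W (GaugeField.gaugeAct g W') b‖ ^ 2) :
    ∀ W' : GaugeField (F.P K) 0 (Matrix.specialUnitaryGroup (Fin 2) ℂ), W' ∈ regFibrePr F n K hnK.le (178 * ε₄) V →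
        ∀ g : GaugeTransf (F.P K) 0 (Matrix.specialUnitaryGroup (Fin 2) ℂ), descTransf F n K hnK.le g = (fun _ => 1) → Opt W (GaugeField.gaugeAct g W') →
          -((4 * ε₀ * (((F.L : ℝ) ^ (K - n)) ^ 3)⁻¹ + 2 * ε₀ * κ₀ * (((F.L : ℝ) ^ (K - n)) ^ 2)⁻¹)
              * ∑ b : PBond (F.P K) 0, ‖pertVar W (GaugeField.gaugeAct g W') b‖ ^ 2) ≤
            ∑ p : Plaq (F.P K) 0, (1 / 2) * ((((((GaugeField.plaqHol W p : Matrix.specialUnitaryGroup (Fin 2) ℂ) : Matrix (Fin 2) (Fin 2) ℂ)) - 1)ᴴ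
              * (((((GaugeField.gaugeAct g W' ⟨p.src, p.μ⟩ : Matrix.specialUnitaryGroup (Fin 2) ℂ) : Matrix (Fin 2) (Fin 2) ℂ) * star (W ⟨p.src, p.μ⟩ : Matrix (Fin 2) (Fin 2) ℂ) - 1)
                  + (W ⟨p.src, p.μ⟩ : Matrix (Fin 2) (Fin 2) ℂ)
                      * (((GaugeField.gaugeAct g W' ⟨p.src.shift p.μ, p.ν⟩ : Matrix.specialUnitaryGroup (Fin 2) ℂ) : Matrix (Fin 2) (Fin 2) ℂ) *
                          star (W ⟨p.src.shift p.μ, p.ν⟩ : Matrix (Fin 2) (Fin 2) ℂ) - 1)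
                      * star (W ⟨p.src, p.μ⟩ : Matrix (Fin 2) (Fin 2) ℂ)
                  - ((W ⟨p.src, p.μ⟩ * W ⟨p.src.shift p.μ, p.ν⟩ * (W ⟨p.src.shift p.ν, p.μ⟩)⁻¹ : Matrix.specialUnitaryGroup (Fin 2) ℂ) :
                        Matrix (Fin 2) (Fin 2) ℂ)
                      * (((GaugeField.gaugeAct g W' ⟨p.src.shift p.ν, p.μ⟩ : Matrix.specialUnitaryGroup (Fin 2) ℂ) : Matrix (Fin 2) (Fin 2) ℂ) *
                          star (W ⟨p.src.shift p.ν, p.μ⟩ : Matrix (Fin 2) (Fin 2) ℂ) - 1)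
                      * star ((W ⟨p.src, p.μ⟩ * W ⟨p.src.shift p.μ, p.ν⟩ * (W ⟨p.src.shift p.ν, p.μ⟩)⁻¹ : Matrix.specialUnitaryGroup (Fin 2) ℂ) :
                        Matrix (Fin 2) (Fin 2) ℂ)
                  - ((GaugeField.plaqHol W p : Matrix.specialUnitaryGroup (Fin 2) ℂ) : Matrix (Fin 2) (Fin 2) ℂ)
                      * (((GaugeField.gaugeAct g W' ⟨p.src, p.ν⟩ : Matrix.specialUnitaryGroup (Fin 2) ℂ) : Matrix (Fin 2) (Fin 2) ℂ) * star (W ⟨p.src, p.ν⟩ : Matrix (Fin 2) (Fin 2) ℂ) - 1)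
                      * star ((GaugeField.plaqHol W p : Matrix.specialUnitaryGroup (Fin 2) ℂ) : Matrix (Fin 2) (Fin 2) ℂ))
                * ((GaugeField.plaqHol W p : Matrix.specialUnitaryGroup (Fin 2) ℂ) : Matrix (Fin 2) (Fin 2) ℂ))).trace).re := by
  intro W' hW' g hg hopt
  obtain ⟨Γ₀, hΓ₀0, hΓ₀d, hvel⟩ := hCV W' hW' g hg hopt
  -- the bond field in the letters of `lin_ge_neg_of_constraintVelocity`
  set Y : PBond (F.P K) 0 → Matrix (Fin 2) (Fin 2) ℂ := fun b =>
    ((GaugeField.gaugeAct g W' b : Matrix.specialUnitaryGroup (Fin 2) ℂ) : Matrix (Fin 2) (Fin 2) ℂ) * star ((W b : Matrix.specialUnitaryGroup (Fin 2) ℂ) : Matrix (Fin 2) (Fin 2) ℂ) - 1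
    with hYdef
  have hYp : ∀ b : PBond (F.P K) 0, pertVar W (GaugeField.gaugeAct g W') b = Y b := fun b => by rw [hYdef, pertVar_eq]
  have hY : ∀ b : PBond (F.P K) 0, ‖Y b‖ ≤ 1 / 2 := fun b => by rw [← hYp b]; exact hSUP W' hW' g hg hopt b
  have hΓ₀d' : ∀ b : PBond (F.P K) 0, HasDerivAt (fun s : ℝ => (Γ₀ s b : Matrix (Fin 2) (Fin 2) ℂ))
      ((fun b => mlog (1 + Y b)) b * (W b : Matrix (Fin 2) (Fin 2) ℂ)) 0 := fun b => by
    have h := hΓ₀d b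
    rw [hYp b] at h
    exact h
  have hκ : ∑ c : PBond (F.P K) (K - n),
      ‖deriv (fun s : ℝ => ((Averaging.iter (fun i => blockAvg (P := F.P K) (j := i) (expMeanLogSU (n := Fin 2))) (K - n) (Γ₀ s) c :
          Matrix.specialUnitaryGroup (Fin 2) ℂ) : Matrix (Fin 2) (Fin 2) ℂ)) 0‖
        ≤ κ₀ * ((F.L : ℝ) ^ (K - n))⁻¹ * ∑ b : PBond (F.P K) 0, ‖Y b‖ ^ 2 + 0 := by
    simp only [hYp] at hvel
    rw [add_zero]
    exact hvel
  have h := lin_ge_neg_of_constraintVelocity F hnK.le hcrit hε₀ hε hWreg Y (fun b => mlog (1 + Y b)) hY (fun _ => rfl) Γ₀ hΓ₀0 hΓ₀d' hκ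
  have hsq : ∑ b : PBond (F.P K) 0, ‖pertVar W (GaugeField.gaugeAct g W') b‖ ^ 2 = ∑ b : PBond (F.P K) 0, ‖Y b‖ ^ 2 :=
    Finset.sum_congr rfl fun b _ => by rw [hYp b]
  have e : -((4 * ε₀ * (((F.L : ℝ) ^ (K - n)) ^ 3)⁻¹ + 2 * ε₀ * κ₀ * (((F.L : ℝ) ^ (K - n)) ^ 2)⁻¹)
        * ∑ b : PBond (F.P K) 0, ‖pertVar W (GaugeField.gaugeAct g W') b‖ ^ 2)
      = -(2 * ε₀ * ((F.L : ℝ) ^ (K - n))⁻¹) * 0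
        - (4 * ε₀ * (((F.L : ℝ) ^ (K - n)) ^ 3)⁻¹ + 2 * ε₀ * ((F.L : ℝ) ^ (K - n))⁻¹ * (κ₀ * ((F.L : ℝ) ^ (K - n))⁻¹)) *
          ∑ b : PBond (F.P K) 0, ‖Y b‖ ^ 2 := by
    rw [hsq]; ring
  rw [e]
  exact h

/-- **COMPOSED WITH `hrepr_of_rows`**: [SEL] ∧ [RP] ∧ (SUP) ∧ (CV₀) at a reading-R2 critical `W ∈ 𝔘_k(ε₀)` ⟹ `growth142_T3`'s pinned growth input `hrepr` at `θ := 0` with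
`C_L := 4ε₀L^{−3(K−n)} + 2ε₀κ₀L^{−2(K−n)}`. [cite: Balaban1985Variational, (141)-(143) p.299, Prop. 7 p.299] -/
theorem hrepr_of_SEL_RP_CV (F : T3Family) {n K : ℕ} (hnK : n < K) {ε₀ ε₄ κ₀ CP : ℝ}
    (V : GaugeField (F.P n) 0 (Matrix.specialUnitaryGroup (Fin 2) ℂ)) (W : GaugeField (F.P K) 0 (Matrix.specialUnitaryGroup (Fin 2) ℂ))
    (Opt : GaugeField (F.P K) 0 (Matrix.specialUnitaryGroup (Fin 2) ℂ) → GaugeField (F.P K) 0 (Matrix.specialUnitaryGroup (Fin 2) ℂ) → Prop)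
    (hcrit : IsCritR2 F n K hnK.le V W) (hε₀ : 0 < ε₀) (hε : 10 ^ 10 * (F.L : ℝ) ^ 6 * ε₀ ≤ 1) (hWreg : RegPr F n K ε₀ W)
    (hSEL : ∀ W' : GaugeField (F.P K) 0 (Matrix.specialUnitaryGroup (Fin 2) ℂ), W' ∈ regFibrePr F n K hnK.le (178 * ε₄) V →
        ∃ g : GaugeTransf (F.P K) 0 (Matrix.specialUnitaryGroup (Fin 2) ℂ), descTransf F n K hnK.le g = (fun _ => 1) ∧ Opt W (GaugeField.gaugeAct g W'))
    (hRP : ∀ W' : GaugeField (F.P K) 0 (Matrix.specialUnitaryGroup (Fin 2) ℂ), W' ∈ regFibrePr F n K hnK.le (178 * ε₄) V →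
        ∀ g : GaugeTransf (F.P K) 0 (Matrix.specialUnitaryGroup (Fin 2) ℂ), descTransf F n K hnK.le g = (fun _ => 1) → Opt W (GaugeField.gaugeAct g W') →
          ∑ b : PBond (F.P K) 0, ‖pertVar W (GaugeField.gaugeAct g W') b‖ ^ 2 ≤
            CP * ((F.L : ℝ) ^ (K - n)) ^ 2 * ∑ p : Plaq (F.P K) 0,
              ‖((GaugeField.plaqHol (GaugeField.gaugeAct g W') p : Matrix.specialUnitaryGroup (Fin 2) ℂ) : Matrix (Fin 2) (Fin 2) ℂ)
                  * star ((GaugeField.plaqHol W p : Matrix.specialUnitaryGroup (Fin 2) ℂ) : Matrix (Fin 2) (Fin 2) ℂ) - 1‖ ^ 2)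
    (hSUP : ∀ W' : GaugeField (F.P K) 0 (Matrix.specialUnitaryGroup (Fin 2) ℂ), W' ∈ regFibrePr F n K hnK.le (178 * ε₄) V →
        ∀ g : GaugeTransf (F.P K) 0 (Matrix.specialUnitaryGroup (Fin 2) ℂ), descTransf F n K hnK.le g = (fun _ => 1) → Opt W (GaugeField.gaugeAct g W') →
          ∀ b : PBond (F.P K) 0, ‖pertVar W (GaugeField.gaugeAct g W') b‖ ≤ 1 / 2)
    (hCV : ∀ W' : GaugeField (F.P K) 0 (Matrix.specialUnitaryGroup (Fin 2) ℂ), W' ∈ regFibrePr F n K hnK.le (178 * ε₄) V →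
        ∀ g : GaugeTransf (F.P K) 0 (Matrix.specialUnitaryGroup (Fin 2) ℂ), descTransf F n K hnK.le g = (fun _ => 1) → Opt W (GaugeField.gaugeAct g W') →
          ∃ Γ₀ : ℝ → GaugeField (F.P K) 0 (Matrix.specialUnitaryGroup (Fin 2) ℂ), Γ₀ 0 = W ∧
            (∀ b : PBond (F.P K) 0, HasDerivAt (fun s : ℝ => (Γ₀ s b : Matrix (Fin 2) (Fin 2) ℂ))
              (mlog (1 + pertVar W (GaugeField.gaugeAct g W') b) * (W b : Matrix (Fin 2) (Fin 2) ℂ)) 0) ∧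
            ∑ c : PBond (F.P K) (K - n),
                ‖deriv (fun s : ℝ => ((Averaging.iter (fun i => blockAvg (P := F.P K) (j := i) (expMeanLogSU (n := Fin 2))) (K - n) (Γ₀ s) c :
                    Matrix.specialUnitaryGroup (Fin 2) ℂ) : Matrix (Fin 2) (Fin 2) ℂ)) 0‖
              ≤ κ₀ * ((F.L : ℝ) ^ (K - n))⁻¹ * ∑ b : PBond (F.P K) 0, ‖pertVar W (GaugeField.gaugeAct g W') b‖ ^ 2) :
    ∀ W' : GaugeField (F.P K) 0 (Matrix.specialUnitaryGroup (Fin 2) ℂ), W' ∈ regFibrePr F n K hnK.le (178 * ε₄) V →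
        ∃ g : GaugeTransf (F.P K) 0 (Matrix.specialUnitaryGroup (Fin 2) ℂ), descTransf F n K hnK.le g = (fun _ => 1) ∧
          (∑ b : PBond (F.P K) 0, ‖pertVar W (GaugeField.gaugeAct g W') b‖ ^ 2 ≤
            CP * ((F.L : ℝ) ^ (K - n)) ^ 2 * ∑ p : Plaq (F.P K) 0,
              ‖((GaugeField.plaqHol (GaugeField.gaugeAct g W') p : Matrix.specialUnitaryGroup (Fin 2) ℂ) : Matrix (Fin 2) (Fin 2) ℂ)
                  * star ((GaugeField.plaqHol W p : Matrix.specialUnitaryGroup (Fin 2) ℂ) : Matrix (Fin 2) (Fin 2) ℂ) - 1‖ ^ 2) ∧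
          (-(0 * ∑ p : Plaq (F.P K) 0,
              ‖((GaugeField.plaqHol (GaugeField.gaugeAct g W') p : Matrix.specialUnitaryGroup (Fin 2) ℂ) : Matrix (Fin 2) (Fin 2) ℂ)
                  * star ((GaugeField.plaqHol W p : Matrix.specialUnitaryGroup (Fin 2) ℂ) : Matrix (Fin 2) (Fin 2) ℂ) - 1‖ ^ 2) -
              (4 * ε₀ * (((F.L : ℝ) ^ (K - n)) ^ 3)⁻¹ + 2 * ε₀ * κ₀ * (((F.L : ℝ) ^ (K - n)) ^ 2)⁻¹)
                * ∑ b : PBond (F.P K) 0, ‖pertVar W (GaugeField.gaugeAct g W') b‖ ^ 2 ≤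
            ∑ p : Plaq (F.P K) 0, (1 / 2) * ((((((GaugeField.plaqHol W p : Matrix.specialUnitaryGroup (Fin 2) ℂ) : Matrix (Fin 2) (Fin 2) ℂ)) - 1)ᴴ
              * (((((GaugeField.gaugeAct g W' ⟨p.src, p.μ⟩ : Matrix.specialUnitaryGroup (Fin 2) ℂ) : Matrix (Fin 2) (Fin 2) ℂ) * star (W ⟨p.src, p.μ⟩ : Matrix (Fin 2) (Fin 2) ℂ) - 1)
                  + (W ⟨p.src, p.μ⟩ : Matrix (Fin 2) (Fin 2) ℂ)
                      * (((GaugeField.gaugeAct g W' ⟨p.src.shift p.μ, p.ν⟩ : Matrix.specialUnitaryGroup (Fin 2) ℂ) : Matrix (Fin 2) (Fin 2) ℂ) *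
                          star (W ⟨p.src.shift p.μ, p.ν⟩ : Matrix (Fin 2) (Fin 2) ℂ) - 1)
                      * star (W ⟨p.src, p.μ⟩ : Matrix (Fin 2) (Fin 2) ℂ)
                  - ((W ⟨p.src, p.μ⟩ * W ⟨p.src.shift p.μ, p.ν⟩ * (W ⟨p.src.shift p.ν, p.μ⟩)⁻¹ : Matrix.specialUnitaryGroup (Fin 2) ℂ) :
                        Matrix (Fin 2) (Fin 2) ℂ)
                      * (((GaugeField.gaugeAct g W' ⟨p.src.shift p.ν, p.μ⟩ : Matrix.specialUnitaryGroup (Fin 2) ℂ) : Matrix (Fin 2) (Fin 2) ℂ) *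
                          star (W ⟨p.src.shift p.ν, p.μ⟩ : Matrix (Fin 2) (Fin 2) ℂ) - 1)
                      * star ((W ⟨p.src, p.μ⟩ * W ⟨p.src.shift p.μ, p.ν⟩ * (W ⟨p.src.shift p.ν, p.μ⟩)⁻¹ : Matrix.specialUnitaryGroup (Fin 2) ℂ) :
                        Matrix (Fin 2) (Fin 2) ℂ)
                  - ((GaugeField.plaqHol W p : Matrix.specialUnitaryGroup (Fin 2) ℂ) : Matrix (Fin 2) (Fin 2) ℂ)
                      * (((GaugeField.gaugeAct g W' ⟨p.src, p.ν⟩ : Matrix.specialUnitaryGroup (Fin 2) ℂ) : Matrix (Fin 2) (Fin 2) ℂ) * star (W ⟨p.src, p.ν⟩ : Matrix (Fin 2) (Fin 2) ℂ) - 1)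
                      * star ((GaugeField.plaqHol W p : Matrix.specialUnitaryGroup (Fin 2) ℂ) : Matrix (Fin 2) (Fin 2) ℂ))
                * ((GaugeField.plaqHol W p : Matrix.specialUnitaryGroup (Fin 2) ℂ) : Matrix (Fin 2) (Fin 2) ℂ))).trace).re) :=
  hrepr_of_rows F hnK V W Opt hSEL hRP (hFV_of_constraintVelocity F hnK V W Opt hcrit hε₀ hε hWreg hSUP hCV)

end Summit.QuantumFields.YangMills.Theorems.Prop7GrowthRowFV

end
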